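import Literature.Computability.AlgebraicComplexity.ChowReciprocityDefs
import HarnessLib

/-!
# Chow reciprocity, brick A2 (objects): row exponent matrices and the restitution `depolarize`

Cell `val-lit`, PROGRAMME #6 (`chowReciprocity_holds`; architect's note
`HOME/bip/NOTE-p7g5-chowReciprocity-discharge-sizing.md`), the three auxiliary objects of brick A2
(`ChowPolarization.lean`, which proves everything about them) on top of `ChowReciprocityDefs.lean`
(index convention (form, variable) = `Fin d × Fin N`; `polarize N n d` = the polarisation `ι_{n→d}`,
the `t₀⋯t_{d-1}`-coefficient of `F(formCoeff_n(Σ_kk t_kk ℓ_kk^n))`). Rectangular versions of the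
square-case `colExp` / `multCoef` / `plethysmRestitution` of `ChowPlethysmBridge.lean`:

* `ChowReciprocity.rowExp J` — the exponent matrix `M_J ∈ ℕ^{d×N}` whose `kk`-th row is the exponent
  `J kk` of degree `n` (`J : Fin d → DegIdx (Fin N) n` a word of exponents), i.e. the exponent of the
  monomial `∏_kk Y_{kk}^{J kk}` of `k[Mat_{d×N}]`;
* `ChowReciprocity.rowMultCoef J = ∏_kk multinomial(J kk)` — the weight of the Veronese rows;
* `ChowReciprocity.depolarize N n d` — the RESTITUTION
  `Ξ(p) = Σ_J (coeff_{M_J}(p) / (d! · rowMultCoef J)) · X_{J 0} ⋯ X_{J (d-1)}`, the inverse of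
  `polarize N n d` between forms of degree `d` on `Sym^n` and form-symmetric polynomials of form
  degrees `(n,…,n)` (proved in `ChowPolarization.lean`: `depolarize_polarize`, `polarize_depolarize`).

Honest framing: classical polarisation/restitution bookkeeping (Landsberg GCT §9.1, Ex. 9.1.2.1) for
DIP 2020's toy separation; nothing here bears on VP ≠ VNP, which is NOT proved.

## References

* J. M. Landsberg, *Geometric Complexity Theory* (CUP 2017), §9.1.1–9.1.2, Ex. 9.1.2.1
  (`Sym^d(Sym^n V) ⊂ V^{⊗nd}`; `h_{d,n}ᵀ = h_{n,d}`). [Landsberg2017]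
-/

noncomputable section

open MvPolynomial

namespace Literature.Computability.AlgebraicComplexity

namespace ChowReciprocity

variable {k : Type} [Field k] {N n d : ℕ}

/-- The exponent matrix `M_J ∈ ℕ^{d × N}` whose `kk`-th ROW is the exponent vector `J kk` (`|J kk| = n`):
the exponent of the monomial `∏_kk Y_{kk}^{J kk}` of `k[Mat_{d×N}]` (the tensor `⊗_kk x^{J kk}` of
`⊗^d Sym^n V` written as a polynomial). [cite: Landsberg2017, Ex. 9.1.2.1 (Sym^d(Sym^n V) ⊂ V^{⊗nd})] -/
def rowExp (J : Fin d → DegIdx (Fin N) n) : Fin d × Fin N →₀ ℕ :=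
  Finsupp.equivFunOnFinite.symm fun li => (J li.1).1 li.2

/-- The product of the multinomial coefficients of the rows of `M_J` — the weight with which the
monomial `Y^{M_J}` appears in the product of the Veronese rows `coeff_{J kk}(ℓ_kk^n)` (a positive
integer). [cite: Landsberg2017, Ex. 9.1.2.1 (Sym^d(Sym^n V) ⊂ V^{⊗nd})] -/
def rowMultCoef (J : Fin d → DegIdx (Fin N) n) : ℕ :=
  ∏ kk : Fin d, (J kk).1.multinomial

variable (N n d) in
/-- **Restitution** `Ξ : k[Mat_{d×N}] → k[Sym^n k^N]_d`,
`Ξ(p) = Σ_J (coeff_{M_J}(p) / (d! · rowMultCoef J)) · X_{J 0} ⋯ X_{J (d-1)}` (sum over words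
`J : Fin d → DegIdx (Fin N) n`): the inverse of the polarisation `polarize N n d` between forms of
degree `d` and form-symmetric polynomials of form degrees `(n,…,n)` (characteristic zero; proved in
`ChowPolarization.lean`). [cite: Landsberg2017, Ex. 9.1.2.1 (Sym^d(Sym^n V) ⊂ V^{⊗nd})] -/
def depolarize (p : MvPolynomial (Fin d × Fin N) k) : MvPolynomial (DegIdx (Fin N) n) k :=
  ∑ J : Fin d → DegIdx (Fin N) n,
    C (coeff (rowExp J) p / ((d.factorial : k) * rowMultCoef J)) * ∏ kk : Fin d, X (J kk)

end ChowReciprocity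

end Literature.Computability.AlgebraicComplexity

end
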